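import Literature.Computability.Learning.EvalPFP
import Literature.Computability.Learning.TablesPFP
import HarnessLib

/-!
# The `AC⁰[p]` learner: coin layout of one run and the hypothesis record from coins and answers

Machine-layer groundwork for the named fact `Literature.Computability.Learning.cikk_learn_AC0Mod`
(CIKK 2016, Cor. 5.4). DESIGN (B6; see NOTES.md "MACHINE-LAYER BLUEPRINT"):

Coin segment of one run (parameters `n, k = 2^κ, β, T = 2^τ, ℓ, Q = p^te, kk, t`), fields in order:
`i` (ℓ bits) · `z` (Q² bits) · `w` (2^ℓ bits) · `m` (τ+1 bits) · vN fillers (ONE input string of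
`2T(kn+kβ)` bits: per block `k` points then `k` β-bit blocks `y` with junk `y / p` and position
`y % p`) · ideal labels (2T β-blocks, value `% p`) · `u`, `u'` (2 β-blocks) · GL seeds (kk·k β-blocks)
· GL guesses (kk β-blocks) · `Pb` (k bits) · DP tuple (k × (n bits + β-block, junk `y / p`)) ·
steps (t × (κ bits + k(n+β-block))) · `q₀` (one β-block). A segment is VALID iff every β-block has
value `< p · (2^β / p)`; on valid segments all derived field/junk values are exactly uniform.

Answer layout of one run: table answers (`L·L·2Tk` bits, entry `(j,c)` at `((jL+c)·2Tk)`) ·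
filler answers (`2T·k` bits: `f` at the points of the filler blocks) · DP answers (`k` bits).

The hypothesis record is `EvalPFP.hypRecP` with tables `TablesPFP.tablesN`, real labels
`labR c = blkValN p n k β fillers fillerAnswers c`, and all fields sliced from the segment.
(To be completed: typed recipe `hypN`, `coinsToRunP`, validity, `hyp_codeFP`, `hypPFn_apply`.)
-/

namespace Literature.Computability.Learning

namespace Modp

variable [P : PrimeP]

section Layout

variable (n k β T ℓ Q L kk t κ τ : ℕ)

/-- Offset of the seed `z`. [folklore] -/
def offZ : ℕ := ℓ
/-- Offset of the advice `w`. [folklore] -/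
def offWP : ℕ := offZ ℓ + Q * Q
/-- Offset of the hybrid index `m`. [folklore] -/
def offM : ℕ := offWP ℓ Q + L
/-- Offset of the vN fillers (one input string). [folklore] -/
def offFil : ℕ := offM ℓ Q L + (τ + 1)
/-- Offset of the ideal labels. [folklore] -/
def offLab : ℕ := offFil ℓ Q L τ + T * 2 * (k * n + k * β)
/-- Offset of `u, u'`. [folklore] -/
def offU : ℕ := offLab n k β T ℓ Q L τ + T * 2 * β
/-- Offset of the GL seeds. [folklore] -/
def offSeeds : ℕ := offU n k β T ℓ Q L τ + 2 * β
/-- Offset of the GL guesses. [folklore] -/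
def offGuess : ℕ := offSeeds n k β T ℓ Q L τ + kk * k * β
/-- Offset of the trusted-position bits. [folklore] -/
def offPbP : ℕ := offGuess n k β T ℓ Q L kk τ + kk * β
/-- Offset of the DP tuple. [folklore] -/
def offTup : ℕ := offPbP n k β T ℓ Q L kk τ + k
/-- Offset of the steps. [folklore] -/
def offSteps : ℕ := offTup n k β T ℓ Q L kk τ + k * (n + β)
/-- Length of one step. [folklore] -/
def stepLenP : ℕ := κ + k * (n + β)
/-- Offset of the junk coin. [folklore] -/
def offJunk : ℕ := offSteps n k β T ℓ Q L kk τ + t * stepLenP n k β κ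
/-- **Length of the coin segment of one run.** [folklore] -/
def runLenP : ℕ := offJunk n k β T ℓ Q L kk t κ τ + β

end Layout

/-! ### The typed recipe -/

section Recipe

open Literature.Computability.Complexity Literature.Computability.Complexity.GaussRank
  Literature.Computability.Cryptography Literature.Computability.MetaComplexity _root_.Computability CodeFP

/-- The typed parameter record
`⟨1ⁿ, ⟨1ᵏ, ⟨1^β, ⟨1ᵀ, ⟨1^ℓ, ⟨1ᴸ, ⟨1^Q, ⟨1^{kk}, ⟨1^{KK}, ⟨1ᵗ, ⟨1^κ, ⟨1^τ, ⟨θN, θD⟩⟩⟩⟩⟩⟩⟩⟩⟩⟩⟩⟩⟩`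
(`L = 2^ℓ`, `Q = p^{te}`, `KK = p^{kk}` the enumeration pad, `k = 2^κ`, `T = 2^τ`). [folklore] -/
abbrev PrmT : Type := ℕ × (ℕ × (ℕ × (ℕ × (ℕ × (ℕ × (ℕ × (ℕ × (ℕ × (ℕ × (ℕ × (ℕ × (ℕ × ℕ))))))))))))

/-- Its code. [folklore] -/
abbrev prmE : PrmT → List Bool :=
  pairE unE (pairE unE (pairE unE (pairE unE (pairE unE (pairE unE (pairE unE (pairE unE (pairE unE (pairE unE (pairE unE (pairE unE
    (pairE natE natE))))))))))))

namespace PrmT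
variable (π : PrmT)
/-- `n`. [folklore] -/ abbrev n : ℕ := π.1
/-- `k`. [folklore] -/ abbrev k : ℕ := π.2.1
/-- `β`. [folklore] -/ abbrev β : ℕ := π.2.2.1
/-- `T`. [folklore] -/ abbrev T : ℕ := π.2.2.2.1
/-- `ℓ`. [folklore] -/ abbrev ℓ : ℕ := π.2.2.2.2.1
/-- `L`. [folklore] -/ abbrev L : ℕ := π.2.2.2.2.2.1
/-- `Q`. [folklore] -/ abbrev Q : ℕ := π.2.2.2.2.2.2.1
/-- `kk`. [folklore] -/ abbrev kk : ℕ := π.2.2.2.2.2.2.2.1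
/-- `KK`. [folklore] -/ abbrev KK : ℕ := π.2.2.2.2.2.2.2.2.1
/-- `t`. [folklore] -/ abbrev t : ℕ := π.2.2.2.2.2.2.2.2.2.1
/-- `κ`. [folklore] -/ abbrev κ : ℕ := π.2.2.2.2.2.2.2.2.2.2.1
/-- `τ`. [folklore] -/ abbrev τ : ℕ := π.2.2.2.2.2.2.2.2.2.2.2.1
/-- `θN`. [folklore] -/ abbrev θN : ℕ := π.2.2.2.2.2.2.2.2.2.2.2.2.1
/-- `θD`. [folklore] -/ abbrev θD : ℕ := π.2.2.2.2.2.2.2.2.2.2.2.2.2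
/-- The block length `N = 2T(kn + kβ)`. [folklore] -/ abbrev N : ℕ := π.T * 2 * (π.k * π.n + π.k * π.β)
end PrmT

/-- A slice of the segment (padded to its nominal length). [folklore] -/
def sl (seg : List Bool) (o len : ℕ) : List Bool := (seg.drop o).takeD len false

/-- The value of a slice (least significant bit first). [folklore] -/
def slv (seg : List Bool) (o len : ℕ) : ℕ := bitsToNat (sl seg o len)

variable (π : PrmT) (seg ans : List Bool)

/-- The field element of the β-block at offset `o`: its value mod `p`. [folklore] -/
def fieldAt (o : ℕ) : ℕ := slv seg o π.β % 𝔭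

/-- The junk of the β-block at offset `o`: its value div `p`. [folklore] -/
def junkAt (o : ℕ) : ℕ := slv seg o π.β / 𝔭

/-- The `(n+β)`-bit point-with-junk string from a point slice at `ox` and a β-block at `oy`. [folklore] -/
def pointJunkStr (ox oy : ℕ) : List Bool := sl seg ox π.n ++ (natE (junkAt π seg oy)).takeD π.β false

/-- The typed predictor record `P`. [folklore] -/
abbrev PredT : Type := ((ℕ × (ℕ × (ℕ × ℕ))) × (ℕ × (ℕ × (ℕ × ℕ)))) × (List Bool × (List Bool × (List (List Bool) × List Bool)))

/-- Its code (`= predRec (predHdr (ampHdr n k β T) Q ℓ N L) ibits wbits (body tables) zbits`). [folklore] -/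
abbrev predE : PredT → List Bool :=
  pairE (pairE (pairE unE (pairE unE (pairE unE unE))) (pairE unE (pairE unE (pairE unE unE)))) (pairE strE (pairE strE (pairE (rawE strE) strE)))

/-- **The predictor record** from the segment and the table answers. [folklore] -/
noncomputable def predOf : PredT :=
  (((π.n, (π.k, (π.β, π.T))), (π.Q, (π.ℓ, (π.N, π.L)))),
   (sl seg 0 π.ℓ, (sl seg (offWP π.ℓ π.Q) π.L,
    (tablesN π.Q π.ℓ π.n π.k π.β π.T π.L (sl seg 0 π.ℓ) (sl seg (offZ π.ℓ) (π.Q * π.Q)) ans, sl seg (offZ π.ℓ) (π.Q * π.Q)))))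

/-- The offset of the filler answers in the answer string (after the `L·L` entries of `2Tk` bits). [folklore] -/
def ansOffFil : ℕ := π.L * π.L * (π.T * 2 * π.k)

/-- The offset of the DP-tuple answers. [folklore] -/
def ansOffTup : ℕ := ansOffFil π + π.T * 2 * π.k

/-- **The vN record**: hybrid index, the fillers (one input string), the real labels
`Σᵢ r_{c,i} f(x_{c,i})` from the filler answers (`blkValN`), the ideal labels, `u`, `u'`. [folklore] -/
noncomputable def vnOf : VnRecT :=
  (predE (predOf π seg ans),
   (min (slv seg (offM π.ℓ π.Q π.L) (π.τ + 1) % (π.T * 2)) (π.T * 2),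
    (sl seg (offFil π.ℓ π.Q π.L π.τ) π.N,
     ((List.range (π.T * 2)).map fun c => blkValN 𝔭 π.n π.k π.β (sl seg (offFil π.ℓ π.Q π.L π.τ) π.N) (sl ans (ansOffFil π) (π.T * 2 * π.k)) c,
      ((List.range (π.T * 2)).map fun c => fieldAt π seg (offLab π.n π.k π.β π.T π.ℓ π.Q π.L π.τ + c * π.β),
       (fieldAt π seg (offU π.n π.k π.β π.T π.ℓ π.Q π.L π.τ), fieldAt π seg (offU π.n π.k π.β π.T π.ℓ π.Q π.L π.τ + π.β)))))))

/-- **The GL record**: dimensions, `kk`, the pad, seeds, guesses, threshold. [folklore] -/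
noncomputable def glOf : GlRecT 𝔭 :=
  (vnOf π seg ans, ((π.n, (π.k, π.β)), (π.kk, (π.KK,
    ((List.range π.kk).map fun tt => (List.range π.k).map fun j =>
        ((fieldAt π seg (offSeeds π.n π.k π.β π.T π.ℓ π.Q π.L π.τ + (tt * π.k + j) * π.β) : ℕ) : ZMod 𝔭),
     ((List.range π.kk).map fun tt => ((fieldAt π seg (offGuess π.n π.k π.β π.T π.ℓ π.Q π.L π.kk π.τ + tt * π.β) : ℕ) : ZMod 𝔭),
      (π.θN, π.θD)))))))

/-- The typed DP record and junk bits: `⟨⟨Gr, ⟨⟨1^{n+β}, ⟨1ᵏ, 1ᵗ⟩⟩, ⟨Pb, ⟨abits, ⟨vbits, steps⟩⟩⟩⟩⟩, qbits⟩`. [folklore] -/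
abbrev HypOutT (p : ℕ) : Type :=
  (GlRecT p × ((ℕ × (ℕ × ℕ)) × (List Bool × (List Bool × (List Bool × List (ℕ × List Bool)))))) × List Bool

/-- Its code (`= boolPair (dpRec (glRecE p Gr) (n+β) k t Pb abits vbits (body steps)) qbits`). [folklore] -/
abbrev hypOutE (p : ℕ) : HypOutT p → List Bool :=
  pairE (pairE (glRecE p) (pairE (pairE unE (pairE unE unE)) (pairE strE (pairE strE (pairE strE (rawE (pairE unE strE))))))) strE

/-- **The hypothesis record of one run from the segment and the answers.**
[cite: CarmosinoImpagliazzoKabanetsKolokolova2016, §5 (complete algorithm)] -/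
noncomputable def hypN : HypOutT 𝔭 :=
  let oT := offTup π.n π.k π.β π.T π.ℓ π.Q π.L π.kk π.τ
  let oS := offSteps π.n π.k π.β π.T π.ℓ π.Q π.L π.kk π.τ
  let sL := stepLenP π.n π.k π.β π.κ
  ((glOf π seg ans,
    ((π.n + π.β, (π.k, π.t)),
     (sl seg (offPbP π.n π.k π.β π.T π.ℓ π.Q π.L π.kk π.τ) π.k,
      (((List.range π.k).map fun i => pointJunkStr π seg (oT + i * (π.n + π.β)) (oT + i * (π.n + π.β) + π.n)).flatten,
       (sl ans (ansOffTup π) π.k,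
        (List.range π.t).map fun r =>
          (min (slv seg (oS + r * sL) π.κ % π.k) π.k,
           ((List.range π.k).map fun i => pointJunkStr π seg (oS + r * sL + π.κ + i * (π.n + π.β))
              (oS + r * sL + π.κ + i * (π.n + π.β) + π.n)).flatten)))))),
   (natE (junkAt π seg (offJunk π.n π.k π.β π.T π.ℓ π.Q π.L π.kk π.t π.κ π.τ))).takeD π.β false)

end Recipe

/-! ### Reading the segment -/

section Read

open Literature.Computability.Complexity Literature.Computability.Complexity.GaussRank
  Literature.Computability.Cryptography Literature.Computability.MetaComplexity _root_.Computability CodeFP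

/-- Reading `len` bits at offset `o`. [folklore] -/
def rdBits (seg : List Bool) (o len : ℕ) : Fin len → Bool := fun i => seg.getD (o + i) false

omit P in
/-- A slice of a long enough segment lists `rdBits`. [folklore] -/
theorem sl_eq_ofFn (seg : List Bool) {o len : ℕ} (h : o + len ≤ seg.length) : sl seg o len = List.ofFn (rdBits seg o len) := by
  rw [sl, List.takeD_eq_take _ (by rw [List.length_drop]; omega)]
  apply List.ext_getElem
  · simp; omega
  · intro i h1 h2
    rw [List.length_ofFn] at h2
    simp only [List.getElem_take, List.getElem_drop, List.getElem_ofFn, rdBits]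
    rw [List.getD_eq_getElem]

omit P in
/-- The padded numeral of `x` lists its binary digits. [folklore] -/
theorem takeD_natE_eq_ofFn (D x : ℕ) : (natE x).takeD D false = List.ofFn fun e : Fin D => x.testBit e := by
  apply List.ext_getElem
  · simp [List.takeD_length]
  · intro e h1 h2
    rw [List.length_ofFn] at h2
    have h := getD_takeD (natE x) h2
    rw [List.getD_eq_getElem _ _ h1] at h
    rw [h, List.getElem_ofFn, testBit_eq_getD_encodeNat]

omit P in
/-- The padded numeral of the value of a string of that length is the string. [folklore] -/
theorem takeD_natE_bitsToNat (s : List Bool) : (natE (bitsToNat s)).takeD s.length false = s := by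
  rw [takeD_natE_eq_ofFn]
  apply List.ext_getElem
  · simp
  · intro e h1 h2
    rw [List.getElem_ofFn, Com.testBit_bitsToNat, List.getD_eq_getElem _ _ (by simpa using h2)]

/-- **A β-block is valid**: its value is below `p · B` (`B = 2^β / p`), so that its junk `value / p`
is below `B` and `(junk, value mod p)` is uniform when the block is. [folklore] -/
def BlockValid (β : ℕ) (seg : List Bool) (o : ℕ) : Prop := slv seg o β < 𝔭 * jB 𝔭 β

/-- The junk of a block as an element of `Fin B` (capped; the cap is inactive on valid blocks). [folklore] -/
def junkFin {β : ℕ} (hB : 0 < jB 𝔭 β) (seg : List Bool) (o : ℕ) : Fin (jB 𝔭 β) :=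
  ⟨min (slv seg o β / 𝔭) (jB 𝔭 β - 1), by omega⟩

/-- On a valid block the junk is the quotient. [folklore] -/
theorem junkFin_val {β : ℕ} (hB : 0 < jB 𝔭 β) (seg : List Bool) {o : ℕ} (hv : BlockValid β seg o) :
    ((junkFin hB seg o : Fin (jB 𝔭 β)) : ℕ) = slv seg o β / 𝔭 := by
  have h : slv seg o β / 𝔭 < jB 𝔭 β := Nat.div_lt_of_lt_mul hv
  simp only [junkFin]
  omega

/-- The field element of a block. [folklore] -/
def fieldZ (β : ℕ) (seg : List Bool) (o : ℕ) : ZMod 𝔭 := ((slv seg o β : ℕ) : ZMod 𝔭)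

/-- A point with junk read at `(ox, oy)`. [folklore] -/
def ujAt {n β : ℕ} (hB : 0 < jB 𝔭 β) (seg : List Bool) (ox oy : ℕ) : UJ n 𝔭 β := (rdBits seg ox n, junkFin hB seg oy)

variable (te ℓ n κ β τ kk t : ℕ) (hB : 0 < jB 𝔭 β) (seg : List Bool)

/-- **The run coins read off a coin segment** (layout of this file), every field in the form in
which the machine slices it; `k = 2^κ`, `T = 2^τ`, `Q = p^{te}`. [folklore] -/
noncomputable def coinsToRunP : RunCoinsP n 𝔭 β (2 ^ κ) (2 ^ τ) (2 ^ ℓ) (𝔭 ^ te * 𝔭 ^ te) kk t :=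
  let k := 2 ^ κ
  let T := 2 ^ τ
  let Q := 𝔭 ^ te
  let Bl := k * n + k * β
  let oF := offFil ℓ Q (2 ^ ℓ) τ
  let oT := offTup n k β T ℓ Q (2 ^ ℓ) kk τ
  let oS := offSteps n k β T ℓ Q (2 ^ ℓ) kk τ
  let sL := stepLenP n k β κ
  (((((boolFunEquivFin ℓ (rdBits seg 0 ℓ), rdBits seg (offZ ℓ) (Q * Q), rdBits seg (offWP ℓ Q) (2 ^ ℓ)),
      (⟨slv seg (offM ℓ Q (2 ^ ℓ)) (τ + 1) % (T * 2), Nat.mod_lt _ (by positivity)⟩,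
       fun c => (fun i => ujAt hB seg (oF + c * Bl + i * n) (oF + c * Bl + k * n + i * β),
                 fun i => fieldZ β seg (oF + c * Bl + k * n + i * β)),
       fun c => fieldZ β seg (offLab n k β T ℓ Q (2 ^ ℓ) τ + c * β),
       fieldZ β seg (offU n k β T ℓ Q (2 ^ ℓ) τ), fieldZ β seg (offU n k β T ℓ Q (2 ^ ℓ) τ + β))),
     (fun tt j => fieldZ β seg (offSeeds n k β T ℓ Q (2 ^ ℓ) τ + (tt * k + j) * β),
      fun tt => fieldZ β seg (offGuess n k β T ℓ Q (2 ^ ℓ) kk τ + tt * β))),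
    (rdBits seg (offPbP n k β T ℓ Q (2 ^ ℓ) kk τ) k,
     fun i => ujAt hB seg (oT + i * (n + β)) (oT + i * (n + β) + n),
     fun r => (⟨slv seg (oS + r * sL) κ % k, Nat.mod_lt _ (by positivity)⟩,
              fun i => ujAt hB seg (oS + r * sL + κ + i * (n + β)) (oS + r * sL + κ + i * (n + β) + n)))),
   junkFin hB seg (offJunk n k β T ℓ Q (2 ^ ℓ) kk t κ τ))

/-- **The segment is valid**: every β-block of the layout is valid. [folklore] -/
def ValidSeg (seg : List Bool) : Prop :=
  let k := 2 ^ κ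
  let T := 2 ^ τ
  let Q := 𝔭 ^ te
  let Bl := k * n + k * β
  (∀ (c : Fin (T * 2)) (i : Fin k), BlockValid β seg (offFil ℓ Q (2 ^ ℓ) τ + c * Bl + k * n + i * β)) ∧
  (∀ c : Fin (T * 2), BlockValid β seg (offLab n k β T ℓ Q (2 ^ ℓ) τ + c * β)) ∧
  BlockValid β seg (offU n k β T ℓ Q (2 ^ ℓ) τ) ∧ BlockValid β seg (offU n k β T ℓ Q (2 ^ ℓ) τ + β) ∧
  (∀ (tt : Fin kk) (j : Fin k), BlockValid β seg (offSeeds n k β T ℓ Q (2 ^ ℓ) τ + (tt * k + j) * β)) ∧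
  (∀ tt : Fin kk, BlockValid β seg (offGuess n k β T ℓ Q (2 ^ ℓ) kk τ + tt * β)) ∧
  (∀ i : Fin k, BlockValid β seg (offTup n k β T ℓ Q (2 ^ ℓ) kk τ + i * (n + β) + n)) ∧
  (∀ (r : Fin t) (i : Fin k), BlockValid β seg (offSteps n k β T ℓ Q (2 ^ ℓ) kk τ + r * stepLenP n k β κ + κ + i * (n + β) + n)) ∧
  BlockValid β seg (offJunk n k β T ℓ Q (2 ^ ℓ) kk t κ τ)

end Read

/-! ### The recipe computes the hypothesis record of the run -/

section Bridge

open Literature.Computability.Complexity Literature.Computability.Complexity.GaussRank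
  Literature.Computability.Cryptography Literature.Computability.MetaComplexity _root_.Computability CodeFP Finset

variable {te ℓ n κ β τ kk t : ℕ} (hB : 0 < jB 𝔭 β) (seg : List Bool)

/-- A valid block's value is `field + p · junk` and is below `2^β`. [folklore] -/
theorem encPosN_block {o : ℕ} (hv : BlockValid β seg o) :
    encPosN (junkFin hB seg o) (fieldZ β seg o) = slv seg o β := by
  rw [encPosN, junkFin_val hB seg hv, fieldZ, ZMod.val_natCast, Nat.mod_add_div]

omit P in
/-- The value of a slice has its bits in the segment. [folklore] -/
theorem testBit_slv (o len : ℕ) (e : Fin len) : (slv seg o len).testBit e = seg.getD (o + e) false := by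
  rw [slv, Com.testBit_bitsToNat, sl, getD_takeD _ e.isLt, List.getD_eq_getElem?_getD, List.getElem?_drop, ← List.getD_eq_getElem?_getD]

/-- **The decoded filler blocks encode back to the filler string**: `encode w = uf ∘ e`, `uf` the
filler bits. [folklore] -/
theorem encode_fillers (hval : ValidSeg te ℓ n κ β τ kk t seg) :
    encode (coinsToRunP te ℓ n κ β τ kk t hB seg).1.1.1.2.2.1 =
      (rdBits seg (offFil ℓ (𝔭 ^ te) (2 ^ ℓ) τ) (2 ^ τ * 2 * (2 ^ κ * n + 2 ^ κ * β))) ∘ ampPIdxEquiv n (2 ^ κ) β (2 ^ τ) := by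
  funext ⟨c, s⟩
  rw [encode_apply, Function.comp_apply, ampPIdxEquiv_eq, rdBits]
  simp only [finProdFinEquiv_apply_val]
  rcases s with ⟨i, j⟩ | ⟨i, e⟩
  · rw [innerEquiv_inl_val]
    simp only [blkBit, encBlk, coinsToRunP, ujAt, rdBits]
    congr 1; ring
  · rw [innerEquiv_inr_val]
    simp only [blkBit, encBlk, coinsToRunP, ujAt]
    rw [encPos_apply, encPosN_block hB seg (hval.1 c i), testBit_slv]
    congr 1; ring

/-- The filler input string is the list of the filler bits. [folklore] -/
theorem inputBits_fillers (hval : ValidSeg te ℓ n κ β τ kk t seg) :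
    inputBits (coinsToRunP te ℓ n κ β τ kk t hB seg).1.1.1.2.2.1 =
      List.ofFn (rdBits seg (offFil ℓ (𝔭 ^ te) (2 ^ ℓ) τ) (2 ^ τ * 2 * (2 ^ κ * n + 2 ^ κ * β))) := by
  rw [inputBits, encode_fillers hB seg hval]
  refine congrArg List.ofFn (funext fun q => ?_)
  simp

/-- **The real labels from the filler answers are `(G(w_c))_c`** for `G = dpGLP f'`, when the filler
answers list `f` at the filler points. [cite: CarmosinoImpagliazzoKabanetsKolokolova2016, Thm. 4.7 (proof: sampling `(𝒟, g^{GL}(𝒟))` with membership queries)] -/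
theorem labR_eq (hval : ValidSeg te ℓ n κ β τ kk t seg) (f : (Fin n → Bool) → Bool) {fans : List Bool}
    (hfans : fans = List.ofFn (ansOf f (rdBits seg (offFil ℓ (𝔭 ^ te) (2 ^ ℓ) τ) (2 ^ τ * 2 * (2 ^ κ * n + 2 ^ κ * β))))) :
    ((List.range (2 ^ τ * 2)).map fun c => blkValN 𝔭 n (2 ^ κ) β
        (List.ofFn (rdBits seg (offFil ℓ (𝔭 ^ te) (2 ^ ℓ) τ) (2 ^ τ * 2 * (2 ^ κ * n + 2 ^ κ * β)))) fans c) =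
      List.ofFn fun c : Fin (2 ^ τ * 2) => (dpGLP (fJ (p := 𝔭) (β := β) f) ((coinsToRunP te ℓ n κ β τ kk t hB seg).1.1.1.2.2.1 c)).val := by
  rw [map_range_eq_ofFn, hfans]
  refine congrArg List.ofFn (funext fun c => ?_)
  rw [blkValN_eq]
  unfold fJ
  rw [← blkG_encBlk, ← blkOf_encode _ c, encode_fillers hB seg hval]

omit P in
/-- The value of `len` bits is below `2^{len}`. [folklore] -/
theorem slv_lt (o len : ℕ) : slv seg o len < 2 ^ len := by
  have := bitsToNat_lt (sl seg o len)
  rwa [sl, List.takeD_length] at this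

/-- `fieldAt` is the value of `fieldZ`. [folklore] -/
theorem fieldAt_eq (π : PrmT) (hβ : π.β = β) (o : ℕ) : fieldAt π seg o = (fieldZ β seg o).val := by
  rw [fieldAt, fieldZ, ZMod.val_natCast, hβ]

/-- `fieldAt` cast back is `fieldZ`. [folklore] -/
theorem cast_fieldAt (π : PrmT) (hβ : π.β = β) (o : ℕ) : ((fieldAt π seg o : ℕ) : ZMod 𝔭) = fieldZ β seg o := by
  rw [fieldAt_eq seg π hβ, ZMod.natCast_zmod_val]

/-- The point-with-junk string is the encoded row of the decoded point. [folklore] -/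
theorem pointJunkStr_eq (π : PrmT) (hn : π.n = n) (hβ : π.β = β) {ox oy : ℕ} (hox : ox + n ≤ seg.length) (hv : BlockValid β seg oy) :
    pointJunkStr π seg ox oy = List.ofFn (encRow (ujAt hB seg ox oy : UJ n 𝔭 β)) := by
  rw [encRow, List.ofFn_fin_append, pointJunkStr, hn, hβ, sl_eq_ofFn seg hox, takeD_natE_eq_ofFn]
  simp only [ujAt, junkAt, junkFin_val hB seg hv, hβ]

omit P in
/-- The output code is the DP record around the GL record. [folklore] -/
theorem hypOutE_apply (p : ℕ) (Gr : GlRecT p) (n' k' t' : ℕ) (Pb ab vb : List Bool) (sc : List (ℕ × List Bool)) (q : List Bool) :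
    hypOutE p ((Gr, ((n', (k', t')), (Pb, (ab, (vb, sc))))), q) =
      boolPair (dpRec (glRecE p Gr) n' k' t' Pb ab vb (OracleCompose.body (sc.map (pairE unE strE)))) q := by
  simp [pairE_apply, dpRec, unE_eq_ones, strE, rawE, body_eq_encList]

/-- The genuine parameter record. [folklore] -/
def prmOf (te ℓ n κ β τ kk t θN θD : ℕ) : PrmT :=
  (n, (2 ^ κ, (β, (2 ^ τ, (ℓ, (2 ^ ℓ, (𝔭 ^ te, (kk, (𝔭 ^ kk, (t, (κ, (τ, (θN, θD)))))))))))))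

variable (te ℓ n κ β τ kk t)

/-- Unfolding the offsets: `runLenP` bounds every field. [folklore] -/
theorem offsets_le : offJunk n (2 ^ κ) β (2 ^ τ) ℓ (𝔭 ^ te) (2 ^ ℓ) kk t κ τ + β = runLenP n (2 ^ κ) β (2 ^ τ) ℓ (𝔭 ^ te) (2 ^ ℓ) kk t κ τ := rfl

variable {te ℓ n κ β τ kk t}

/-- **The recipe computes the hypothesis record of the run** (valid segment of full length, the
filler and DP answers correct): `hypOutE 𝔭 (hypN π seg ans) = hypRecP te ℓ tbls f θN θD ω` with
`ω = coinsToRunP … seg` and `tbls` the recipe's tables.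
[cite: CarmosinoImpagliazzoKabanetsKolokolova2016, §5 (complete algorithm)] -/
theorem hypN_eq (hval : ValidSeg te ℓ n κ β τ kk t seg) (hlen : runLenP n (2 ^ κ) β (2 ^ τ) ℓ (𝔭 ^ te) (2 ^ ℓ) kk t κ τ ≤ seg.length)
    (θN θD : ℕ) {ans : List Bool} (f : (Fin n → Bool) → Bool)
    (hfil : sl ans (ansOffFil (prmOf te ℓ n κ β τ kk t θN θD)) (2 ^ τ * 2 * 2 ^ κ) =
      List.ofFn (ansOf f (rdBits seg (offFil ℓ (𝔭 ^ te) (2 ^ ℓ) τ) (2 ^ τ * 2 * (2 ^ κ * n + 2 ^ κ * β)))))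
    (hdp : sl ans (ansOffTup (prmOf te ℓ n κ β τ kk t θN θD)) (2 ^ κ) =
      List.ofFn (fJ (p := 𝔭) (β := β) f ∘ (coinsToRunP te ℓ n κ β τ kk t hB seg).1.2.2.1)) :
    hypOutE 𝔭 (hypN (prmOf te ℓ n κ β τ kk t θN θD) seg ans) =
      hypRecP te ℓ (tablesN (𝔭 ^ te) ℓ n (2 ^ κ) β (2 ^ τ) (2 ^ ℓ) (sl seg 0 ℓ) (sl seg (offZ ℓ) (𝔭 ^ te * 𝔭 ^ te)) ans) f θN θD
        (coinsToRunP te ℓ n κ β τ kk t hB seg) := by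
  set π := prmOf te ℓ n κ β τ kk t θN θD with hπ
  set ω := coinsToRunP te ℓ n κ β τ kk t hB seg with hω
  -- parameter accessors
  have hπn : π.n = n := rfl
  have hπk : π.k = 2 ^ κ := rfl
  have hπβ : π.β = β := rfl
  have hπT : π.T = 2 ^ τ := rfl
  have hπℓ : π.ℓ = ℓ := rfl
  have hπL : π.L = 2 ^ ℓ := rfl
  have hπQ : π.Q = 𝔭 ^ te := rfl
  have hπkk : π.kk = kk := rfl
  have hπKK : π.KK = 𝔭 ^ kk := rfl
  have hπt : π.t = t := rfl
  have hπκ : π.κ = κ := rfl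
  have hπτ : π.τ = τ := rfl
  have hπθN : π.θN = θN := rfl
  have hπθD : π.θD = θD := rfl
  have hπN : π.N = 2 ^ τ * 2 * (2 ^ κ * n + 2 ^ κ * β) := rfl
  -- the offsets are cumulative
  have hoffs : offZ ℓ + 𝔭 ^ te * 𝔭 ^ te = offWP ℓ (𝔭 ^ te) ∧ offWP ℓ (𝔭 ^ te) + 2 ^ ℓ = offM ℓ (𝔭 ^ te) (2 ^ ℓ) ∧
      offM ℓ (𝔭 ^ te) (2 ^ ℓ) + (τ + 1) = offFil ℓ (𝔭 ^ te) (2 ^ ℓ) τ ∧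
      offFil ℓ (𝔭 ^ te) (2 ^ ℓ) τ + 2 ^ τ * 2 * (2 ^ κ * n + 2 ^ κ * β) = offLab n (2 ^ κ) β (2 ^ τ) ℓ (𝔭 ^ te) (2 ^ ℓ) τ ∧
      offLab n (2 ^ κ) β (2 ^ τ) ℓ (𝔭 ^ te) (2 ^ ℓ) τ + 2 ^ τ * 2 * β = offU n (2 ^ κ) β (2 ^ τ) ℓ (𝔭 ^ te) (2 ^ ℓ) τ ∧
      offU n (2 ^ κ) β (2 ^ τ) ℓ (𝔭 ^ te) (2 ^ ℓ) τ + 2 * β = offSeeds n (2 ^ κ) β (2 ^ τ) ℓ (𝔭 ^ te) (2 ^ ℓ) τ ∧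
      offSeeds n (2 ^ κ) β (2 ^ τ) ℓ (𝔭 ^ te) (2 ^ ℓ) τ + kk * 2 ^ κ * β = offGuess n (2 ^ κ) β (2 ^ τ) ℓ (𝔭 ^ te) (2 ^ ℓ) kk τ ∧
      offGuess n (2 ^ κ) β (2 ^ τ) ℓ (𝔭 ^ te) (2 ^ ℓ) kk τ + kk * β = offPbP n (2 ^ κ) β (2 ^ τ) ℓ (𝔭 ^ te) (2 ^ ℓ) kk τ ∧
      offPbP n (2 ^ κ) β (2 ^ τ) ℓ (𝔭 ^ te) (2 ^ ℓ) kk τ + 2 ^ κ = offTup n (2 ^ κ) β (2 ^ τ) ℓ (𝔭 ^ te) (2 ^ ℓ) kk τ ∧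
      offTup n (2 ^ κ) β (2 ^ τ) ℓ (𝔭 ^ te) (2 ^ ℓ) kk τ + 2 ^ κ * (n + β) = offSteps n (2 ^ κ) β (2 ^ τ) ℓ (𝔭 ^ te) (2 ^ ℓ) kk τ ∧
      offSteps n (2 ^ κ) β (2 ^ τ) ℓ (𝔭 ^ te) (2 ^ ℓ) kk τ + t * stepLenP n (2 ^ κ) β κ = offJunk n (2 ^ κ) β (2 ^ τ) ℓ (𝔭 ^ te) (2 ^ ℓ) kk t κ τ ∧
      offJunk n (2 ^ κ) β (2 ^ τ) ℓ (𝔭 ^ te) (2 ^ ℓ) kk t κ τ + β = runLenP n (2 ^ κ) β (2 ^ τ) ℓ (𝔭 ^ te) (2 ^ ℓ) kk t κ τ :=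
    ⟨rfl, rfl, rfl, rfl, rfl, rfl, rfl, rfl, rfl, rfl, rfl, rfl⟩
  obtain ⟨e1, e2, e3, e4, e5, e6, e7, e8, e9, e10, e11, e12⟩ := hoffs
  have hZ0 : offZ ℓ = ℓ := rfl
  have hsl0 : sl seg 0 ℓ = List.ofFn ((boolFunEquivFin ℓ).symm ω.1.1.1.1.1) := by
    rw [sl_eq_ofFn seg (by omega)]
    exact congrArg List.ofFn (Equiv.symm_apply_apply _ _).symm
  have hslz : sl seg (offZ ℓ) (𝔭 ^ te * 𝔭 ^ te) = List.ofFn ω.1.1.1.1.2.1 := sl_eq_ofFn seg (by omega)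
  have hslw : sl seg (offWP ℓ (𝔭 ^ te)) (2 ^ ℓ) = List.ofFn ω.1.1.1.1.2.2 := sl_eq_ofFn seg (by omega)
  -- the predictor record
  set tbls := tablesN (𝔭 ^ te) ℓ n (2 ^ κ) β (2 ^ τ) (2 ^ ℓ) (sl seg 0 ℓ) (sl seg (offZ ℓ) (𝔭 ^ te * 𝔭 ^ te)) ans with htbls
  set Pstr := predRec (predHdr (ampHdr n (2 ^ κ) β (2 ^ τ)) (𝔭 ^ te) ℓ (2 ^ τ * 2 * (2 ^ κ * n + 2 ^ κ * β)) (2 ^ ℓ))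
    (List.ofFn ((boolFunEquivFin ℓ).symm ω.1.1.1.1.1)) (List.ofFn ω.1.1.1.1.2.2) (OracleCompose.body tbls) (List.ofFn ω.1.1.1.1.2.1)
    with hPstr
  have hP : predE (predOf π seg ans) = Pstr := by
    rw [hPstr, ← hsl0, ← hslz, ← hslw, body_eq_encList]
    simp only [predOf, predE, pairE_apply, predRec, predHdr, ampHdr, unE_eq_ones, hπn, hπk, hπβ, hπT, hπQ, hπℓ, hπN, hπL, strE, rawE,
      List.map_id, htbls, id]
  -- the vN record
  have hfil' : sl seg (offFil ℓ (𝔭 ^ te) (2 ^ ℓ) τ) (2 ^ τ * 2 * (2 ^ κ * n + 2 ^ κ * β)) =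
      List.ofFn (rdBits seg (offFil ℓ (𝔭 ^ te) (2 ^ ℓ) τ) (2 ^ τ * 2 * (2 ^ κ * n + 2 ^ κ * β))) := sl_eq_ofFn seg (by omega)
  have hV : vnOf π seg ans = vnRecOf Pstr (dpGLP (fJ (p := 𝔭) (β := β) f)) ω.1.1.1.2 := by
    rw [vnOf, hP, vnRecOf]
    simp only [hπℓ, hπQ, hπτ, hπT, hπN, hπn, hπk, hπβ, hπL]
    refine Prod.ext rfl (Prod.ext ?_ (Prod.ext ?_ (Prod.ext ?_ (Prod.ext ?_ (Prod.ext ?_ ?_)))))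
    · show min _ _ = ((ω.1.1.1.2.1 : Fin (2 ^ τ * 2)) : ℕ)
      rw [min_eq_left (Nat.mod_lt _ (by positivity)).le]; rfl
    · show sl seg _ _ = inputBits _
      rw [hfil', inputBits_fillers hB seg hval]
    · show List.map _ _ = List.ofFn _
      rw [hfil', labR_eq hB seg hval f hfil]
    · show List.map _ _ = List.ofFn _
      rw [map_range_eq_ofFn]
      exact congrArg List.ofFn (funext fun c => by rw [fieldAt_eq seg π hπβ]; rfl)
    · show fieldAt _ _ _ = ZMod.val _
      rw [fieldAt_eq seg π hπβ]; rfl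
    · show fieldAt _ _ _ = ZMod.val _
      rw [fieldAt_eq seg π hπβ]; rfl
  -- the GL record
  have hG : glOf π seg ans = glRecOf (vnRecOf Pstr (dpGLP (fJ (p := 𝔭) (β := β) f)) ω.1.1.1.2) n (2 ^ κ) β kk ω.1.1.2.1 ω.1.1.2.2 θN θD := by
    rw [glOf, hV, glRecOf]
    simp only [hπkk, hπk, hπn, hπβ, hπKK, hπθN, hπθD, hπT, hπℓ, hπQ, hπτ, hπL]
    refine Prod.ext rfl (Prod.ext rfl (Prod.ext rfl (Prod.ext rfl (Prod.ext ?_ (Prod.ext ?_ rfl)))))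
    · show List.map _ _ = List.ofFn _
      rw [map_range_eq_ofFn]
      refine congrArg List.ofFn (funext fun tt => ?_)
      rw [map_range_eq_ofFn]
      exact congrArg List.ofFn (funext fun j => by rw [cast_fieldAt seg π hπβ]; rfl)
    · show List.map _ _ = List.ofFn _
      rw [map_range_eq_ofFn]
      exact congrArg List.ofFn (funext fun tt => by rw [cast_fieldAt seg π hπβ]; rfl)
  -- the DP part
  have hPb : sl seg (offPbP n (2 ^ κ) β (2 ^ τ) ℓ (𝔭 ^ te) (2 ^ ℓ) kk τ) (2 ^ κ) = List.ofFn ω.1.2.1 := sl_eq_ofFn seg (by omega)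
  have htuple : ∀ xs : Fin (2 ^ κ) → (Fin (n + β) → Bool), tupleBits xs = (List.ofFn fun c => List.ofFn (xs c)).flatten := by
    intro xs; rw [tupleBits_eq_ccat, flatten_ofFn_eq_ccat]
  have habits : ((List.range (2 ^ κ)).map fun i => pointJunkStr π seg (offTup n (2 ^ κ) β (2 ^ τ) ℓ (𝔭 ^ te) (2 ^ ℓ) kk τ + i * (n + β))
      (offTup n (2 ^ κ) β (2 ^ τ) ℓ (𝔭 ^ te) (2 ^ ℓ) kk τ + i * (n + β) + n)).flatten = tupleBits (encRow ∘ ω.1.2.2.1) := by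
    rw [htuple, map_range_eq_ofFn]
    congr 1
    refine congrArg List.ofFn (funext fun i => ?_)
    have hv := hval.2.2.2.2.2.2.1 i
    have hi : (i : ℕ) + 1 ≤ 2 ^ κ := i.isLt
    have hbnd : offTup n (2 ^ κ) β (2 ^ τ) ℓ (𝔭 ^ te) (2 ^ ℓ) kk τ + i * (n + β) + n ≤ seg.length := by
      have := Nat.mul_le_mul_right (n + β) hi
      rw [add_mul, one_mul] at this
      omega
    exact pointJunkStr_eq hB seg π hπn hπβ hbnd hv
  have hsteps : ((List.range t).map fun r =>
      (min (slv seg (offSteps n (2 ^ κ) β (2 ^ τ) ℓ (𝔭 ^ te) (2 ^ ℓ) kk τ + r * stepLenP n (2 ^ κ) β κ) κ % 2 ^ κ) (2 ^ κ),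
       ((List.range (2 ^ κ)).map fun i =>
          pointJunkStr π seg (offSteps n (2 ^ κ) β (2 ^ τ) ℓ (𝔭 ^ te) (2 ^ ℓ) kk τ + r * stepLenP n (2 ^ κ) β κ + κ + i * (n + β))
            (offSteps n (2 ^ κ) β (2 ^ τ) ℓ (𝔭 ^ te) (2 ^ ℓ) kk τ + r * stepLenP n (2 ^ κ) β κ + κ + i * (n + β) + n)).flatten)) =
      List.ofFn fun r : Fin t => ((((ω.1.2.2.2 r).1 : Fin (2 ^ κ)) : ℕ), tupleBits (encRow ∘ (ω.1.2.2.2 r).2)) := by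
    rw [map_range_eq_ofFn]
    refine congrArg List.ofFn (funext fun r => Prod.ext ?_ ?_)
    · show min _ _ = (((ω.1.2.2.2 r).1 : Fin (2 ^ κ)) : ℕ)
      rw [min_eq_left (Nat.mod_lt _ (by positivity)).le]; rfl
    show List.flatten _ = tupleBits _
    rw [htuple, map_range_eq_ofFn]
    congr 1
    refine congrArg List.ofFn (funext fun i => ?_)
    have hv := hval.2.2.2.2.2.2.2.1 r i
    have hi : (i : ℕ) + 1 ≤ 2 ^ κ := i.isLt
    have hr : (r : ℕ) + 1 ≤ t := r.isLt
    have hbnd : offSteps n (2 ^ κ) β (2 ^ τ) ℓ (𝔭 ^ te) (2 ^ ℓ) kk τ + r * stepLenP n (2 ^ κ) β κ + κ + i * (n + β) + n ≤ seg.length := by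
      have h1 := Nat.mul_le_mul_right (n + β) hi
      rw [add_mul, one_mul] at h1
      have h2 := Nat.mul_le_mul_right (stepLenP n (2 ^ κ) β κ) hr
      rw [add_mul, one_mul] at h2
      have hsL : stepLenP n (2 ^ κ) β κ = κ + 2 ^ κ * (n + β) := rfl
      omega
    exact pointJunkStr_eq hB seg π hπn hπβ hbnd hv
  have hq : (natE (junkAt π seg (offJunk n (2 ^ κ) β (2 ^ τ) ℓ (𝔭 ^ te) (2 ^ ℓ) kk t κ τ))).takeD β false = junkBits ω.2 := by
    rw [junkBits, takeD_natE_eq_ofFn]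
    refine congrArg List.ofFn (funext fun e => ?_)
    rw [junkAt, hπβ, show ((ω.2 : Fin (jB 𝔭 β)) : ℕ) = slv seg (offJunk n (2 ^ κ) β (2 ^ τ) ℓ (𝔭 ^ te) (2 ^ ℓ) kk t κ τ) β / 𝔭 from
      junkFin_val hB seg hval.2.2.2.2.2.2.2.2]
  -- assemble
  have hL : hypN π seg ans = ((glOf π seg ans, ((n + β, (2 ^ κ, t)),
      (sl seg (offPbP n (2 ^ κ) β (2 ^ τ) ℓ (𝔭 ^ te) (2 ^ ℓ) kk τ) (2 ^ κ),
       (((List.range (2 ^ κ)).map fun i => pointJunkStr π seg (offTup n (2 ^ κ) β (2 ^ τ) ℓ (𝔭 ^ te) (2 ^ ℓ) kk τ + i * (n + β))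
          (offTup n (2 ^ κ) β (2 ^ τ) ℓ (𝔭 ^ te) (2 ^ ℓ) kk τ + i * (n + β) + n)).flatten,
        (sl ans (ansOffTup π) (2 ^ κ),
         (List.range t).map fun r =>
          (min (slv seg (offSteps n (2 ^ κ) β (2 ^ τ) ℓ (𝔭 ^ te) (2 ^ ℓ) kk τ + r * stepLenP n (2 ^ κ) β κ) κ % 2 ^ κ) (2 ^ κ),
           ((List.range (2 ^ κ)).map fun i =>
              pointJunkStr π seg (offSteps n (2 ^ κ) β (2 ^ τ) ℓ (𝔭 ^ te) (2 ^ ℓ) kk τ + r * stepLenP n (2 ^ κ) β κ + κ + i * (n + β))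
                (offSteps n (2 ^ κ) β (2 ^ τ) ℓ (𝔭 ^ te) (2 ^ ℓ) kk τ + r * stepLenP n (2 ^ κ) β κ + κ + i * (n + β) + n)).flatten)))))),
      (natE (junkAt π seg (offJunk n (2 ^ κ) β (2 ^ τ) ℓ (𝔭 ^ te) (2 ^ ℓ) kk t κ τ))).takeD β false) := rfl
  have hR : hypRecP te ℓ tbls f θN θD ω = boolPair (dpRec (glRecE 𝔭 (glRecOf (vnRecOf Pstr (dpGLP (fJ (p := 𝔭) (β := β) f)) ω.1.1.1.2)
      n (2 ^ κ) β kk ω.1.1.2.1 ω.1.1.2.2 θN θD)) (n + β) (2 ^ κ) t (List.ofFn ω.1.2.1) (tupleBits (encRow ∘ ω.1.2.2.1))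
      (List.ofFn (fJ (p := 𝔭) (β := β) f ∘ ω.1.2.2.1)) (stepsCode fun r => ((ω.1.2.2.2 r).1, encRow ∘ (ω.1.2.2.2 r).2))) (junkBits ω.2) := rfl
  rw [hL, hR, hypOutE_apply, hG, hPb, habits, hdp, hsteps, hq, List.map_ofFn, stepsCode]
  simp only [Function.comp_def, pairE_apply, unE_eq_ones, strE, id]

end Bridge

/-! ### The recipe as a polynomial-time code -/

section Code

open Literature.Computability.Complexity Literature.Computability.Complexity.GaussRank
  Literature.Computability.Cryptography Literature.Computability.MetaComplexity _root_.Computability CodeFP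

/-- The typed argument `⟨π, ⟨seg, ans⟩⟩`. [folklore] -/
abbrev HypInT : Type := PrmT × (List Bool × List Bool)

/-- Its code. [folklore] -/
abbrev hypInE : HypInT → List Bool := pairE prmE (pairE strE strE)

/-! #### Generic slicing codes -/

variable {σ : Type} {eσ : σ → List Bool}

omit P in
/-- A slice is a code in its offset, length and string. [folklore] -/
theorem sl_code {o len : σ → ℕ} {str : σ → List Bool} (ho : CodeFP eσ unE o) (hl : CodeFP eσ unE len) (hs : CodeFP eσ strE str) :
    CodeFP eσ strE (fun x => sl (str x) (o x) (len x)) := (CodeFP.slice.comp (ho.pair (hl.pair hs))).congr fun _ => rfl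

omit P in
/-- The value of a slice is a code. [folklore] -/
theorem slv_code {o len : σ → ℕ} {str : σ → List Bool} (ho : CodeFP eσ unE o) (hl : CodeFP eσ unE len) (hs : CodeFP eσ strE str) :
    CodeFP eσ natE (fun x => slv (str x) (o x) (len x)) := (strVal.comp (sl_code ho hl hs)).congr fun _ => rfl

/-- The field element of a β-block is a code. [folklore] -/
theorem fieldAt_code {π : σ → PrmT} {o : σ → ℕ} {str : σ → List Bool} (hπβ : CodeFP eσ unE (fun x => (π x).β)) (ho : CodeFP eσ unE o)
    (hs : CodeFP eσ strE str) : CodeFP eσ natE (fun x => fieldAt (π x) (str x) (o x)) :=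
  (natMod.comp ((slv_code ho hπβ hs).pair (const _ 𝔭))).congr fun _ => rfl

/-- The junk of a β-block is a code. [folklore] -/
theorem junkAt_code {π : σ → PrmT} {o : σ → ℕ} {str : σ → List Bool} (hπβ : CodeFP eσ unE (fun x => (π x).β)) (ho : CodeFP eσ unE o)
    (hs : CodeFP eσ strE str) : CodeFP eσ natE (fun x => junkAt (π x) (str x) (o x)) :=
  (natDiv.comp ((slv_code ho hπβ hs).pair (const _ 𝔭))).congr fun _ => rfl

/-- The β-bit rendering of the junk is a code. [folklore] -/
theorem junkStr_code {π : σ → PrmT} {o : σ → ℕ} {str : σ → List Bool} (hπβ : CodeFP eσ unE (fun x => (π x).β)) (ho : CodeFP eσ unE o)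
    (hs : CodeFP eσ strE str) : CodeFP eσ strE (fun x => (natE (junkAt (π x) (str x) (o x))).takeD (π x).β false) :=
  (takeD.comp (hπβ.pair (strOfNat.comp (junkAt_code hπβ ho hs)))).congr fun _ => rfl

/-- The point-with-junk string is a code. [folklore] -/
theorem pointJunkStr_code {π : σ → PrmT} {ox oy : σ → ℕ} {str : σ → List Bool} (hπn : CodeFP eσ unE (fun x => (π x).n))
    (hπβ : CodeFP eσ unE (fun x => (π x).β)) (hox : CodeFP eσ unE ox) (hoy : CodeFP eσ unE oy) (hs : CodeFP eσ strE str) :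
    CodeFP eσ strE (fun x => pointJunkStr (π x) (str x) (ox x) (oy x)) :=
  (strAppend.comp ((sl_code hox hπn hs).pair (junkStr_code hπβ hoy hs))).congr fun _ => rfl

/-! #### Parameter accessors and offsets -/

namespace PrmT
omit P in
/-- `n` is a code. [folklore] -/ theorem n_code : CodeFP prmE unE PrmT.n := fst _ _
omit P in
/-- `k` is a code. [folklore] -/ theorem k_code : CodeFP prmE unE PrmT.k := (snd _ _).fst'
omit P in
/-- `β` is a code. [folklore] -/ theorem β_code : CodeFP prmE unE PrmT.β := (snd _ _).snd'.fst'
omit P in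
/-- `T` is a code. [folklore] -/ theorem T_code : CodeFP prmE unE PrmT.T := (snd _ _).snd'.snd'.fst'
omit P in
/-- `ℓ` is a code. [folklore] -/ theorem ℓ_code : CodeFP prmE unE PrmT.ℓ := (snd _ _).snd'.snd'.snd'.fst'
omit P in
/-- `L` is a code. [folklore] -/ theorem L_code : CodeFP prmE unE PrmT.L := (snd _ _).snd'.snd'.snd'.snd'.fst'
omit P in
/-- `Q` is a code. [folklore] -/ theorem Q_code : CodeFP prmE unE PrmT.Q := (snd _ _).snd'.snd'.snd'.snd'.snd'.fst'
omit P in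
/-- `kk` is a code. [folklore] -/ theorem kk_code : CodeFP prmE unE PrmT.kk := (snd _ _).snd'.snd'.snd'.snd'.snd'.snd'.fst'
omit P in
/-- `KK` is a code. [folklore] -/ theorem KK_code : CodeFP prmE unE PrmT.KK := (snd _ _).snd'.snd'.snd'.snd'.snd'.snd'.snd'.fst'
omit P in
/-- `t` is a code. [folklore] -/ theorem t_code : CodeFP prmE unE PrmT.t := (snd _ _).snd'.snd'.snd'.snd'.snd'.snd'.snd'.snd'.fst'
omit P in
/-- `κ` is a code. [folklore] -/ theorem κ_code : CodeFP prmE unE PrmT.κ := (snd _ _).snd'.snd'.snd'.snd'.snd'.snd'.snd'.snd'.snd'.fst'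
omit P in
/-- `τ` is a code. [folklore] -/
theorem τ_code : CodeFP prmE unE PrmT.τ := (snd _ _).snd'.snd'.snd'.snd'.snd'.snd'.snd'.snd'.snd'.snd'.fst'
omit P in
/-- `θN` is a code. [folklore] -/
theorem θN_code : CodeFP prmE natE PrmT.θN := (snd _ _).snd'.snd'.snd'.snd'.snd'.snd'.snd'.snd'.snd'.snd'.snd'.fst'
omit P in
/-- `θD` is a code. [folklore] -/
theorem θD_code : CodeFP prmE natE PrmT.θD := (snd _ _).snd'.snd'.snd'.snd'.snd'.snd'.snd'.snd'.snd'.snd'.snd'.snd'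
omit P in
/-- `N` is a code. [folklore] -/
theorem N_code : CodeFP prmE unE PrmT.N :=
  (unMul.comp ((unMul.comp (T_code.pair (const _ 2))).pair (unAdd.comp ((unMul.comp (k_code.pair n_code)).pair (unMul.comp (k_code.pair β_code)))))).congr
    fun _ => rfl
omit P in
/-- `offWP` is a code. [folklore] -/
theorem offWP_code : CodeFP prmE unE (fun π => offWP π.ℓ π.Q) := (unAdd.comp (ℓ_code.pair (unMul.comp (Q_code.pair Q_code)))).congr fun _ => rfl
omit P in
/-- `offM` is a code. [folklore] -/
theorem offM_code : CodeFP prmE unE (fun π => offM π.ℓ π.Q π.L) := (unAdd.comp (offWP_code.pair L_code)).congr fun _ => rfl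
omit P in
/-- `offFil` is a code. [folklore] -/
theorem offFil_code : CodeFP prmE unE (fun π => offFil π.ℓ π.Q π.L π.τ) :=
  (unAdd.comp (offM_code.pair (unAdd.comp (τ_code.pair (const _ 1))))).congr fun _ => rfl
omit P in
/-- `offLab` is a code. [folklore] -/
theorem offLab_code : CodeFP prmE unE (fun π => offLab π.n π.k π.β π.T π.ℓ π.Q π.L π.τ) := (unAdd.comp (offFil_code.pair N_code)).congr fun _ => rfl
omit P in
/-- `offU` is a code. [folklore] -/
theorem offU_code : CodeFP prmE unE (fun π => offU π.n π.k π.β π.T π.ℓ π.Q π.L π.τ) :=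
  (unAdd.comp (offLab_code.pair (unMul.comp ((unMul.comp (T_code.pair (const _ 2))).pair β_code)))).congr fun _ => rfl
omit P in
/-- `offSeeds` is a code. [folklore] -/
theorem offSeeds_code : CodeFP prmE unE (fun π => offSeeds π.n π.k π.β π.T π.ℓ π.Q π.L π.τ) :=
  (unAdd.comp (offU_code.pair (unMul.comp ((const _ 2).pair β_code)))).congr fun _ => rfl
omit P in
/-- `offGuess` is a code. [folklore] -/
theorem offGuess_code : CodeFP prmE unE (fun π => offGuess π.n π.k π.β π.T π.ℓ π.Q π.L π.kk π.τ) :=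
  (unAdd.comp (offSeeds_code.pair (unMul.comp ((unMul.comp (kk_code.pair k_code)).pair β_code)))).congr fun _ => rfl
omit P in
/-- `offPbP` is a code. [folklore] -/
theorem offPbP_code : CodeFP prmE unE (fun π => offPbP π.n π.k π.β π.T π.ℓ π.Q π.L π.kk π.τ) :=
  (unAdd.comp (offGuess_code.pair (unMul.comp (kk_code.pair β_code)))).congr fun _ => rfl
omit P in
/-- `offTup` is a code. [folklore] -/
theorem offTup_code : CodeFP prmE unE (fun π => offTup π.n π.k π.β π.T π.ℓ π.Q π.L π.kk π.τ) :=
  (unAdd.comp (offPbP_code.pair k_code)).congr fun _ => rfl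
omit P in
/-- `offSteps` is a code. [folklore] -/
theorem offSteps_code : CodeFP prmE unE (fun π => offSteps π.n π.k π.β π.T π.ℓ π.Q π.L π.kk π.τ) :=
  (unAdd.comp (offTup_code.pair (unMul.comp (k_code.pair (unAdd.comp (n_code.pair β_code)))))).congr fun _ => rfl
omit P in
/-- `stepLenP` is a code. [folklore] -/
theorem stepLenP_code : CodeFP prmE unE (fun π => stepLenP π.n π.k π.β π.κ) :=
  (unAdd.comp (κ_code.pair (unMul.comp (k_code.pair (unAdd.comp (n_code.pair β_code)))))).congr fun _ => rfl
omit P in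
/-- `offJunk` is a code. [folklore] -/
theorem offJunk_code : CodeFP prmE unE (fun π => offJunk π.n π.k π.β π.T π.ℓ π.Q π.L π.kk π.t π.κ π.τ) :=
  (unAdd.comp (offSteps_code.pair (unMul.comp (t_code.pair stepLenP_code)))).congr fun _ => rfl
omit P in
/-- `ansOffFil` is a code. [folklore] -/
theorem ansOffFil_code : CodeFP prmE unE ansOffFil :=
  (unMul.comp ((unMul.comp (L_code.pair L_code)).pair (unMul.comp ((unMul.comp (T_code.pair (const _ 2))).pair k_code)))).congr fun _ => rfl
omit P in
/-- `ansOffTup` is a code. [folklore] -/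
theorem ansOffTup_code : CodeFP prmE unE ansOffTup :=
  (unAdd.comp (ansOffFil_code.pair (unMul.comp ((unMul.comp (T_code.pair (const _ 2))).pair k_code)))).congr fun _ => rfl
end PrmT

/-! #### The records -/

/-- **`predOf` is a code.** [folklore] -/
theorem predOf_code : CodeFP hypInE predE (fun a => predOf a.1 a.2.1 a.2.2) := by
  have hπ : CodeFP hypInE prmE (fun a => a.1) := fst _ _
  have hseg : CodeFP hypInE strE (fun a => a.2.1) := (snd _ _).fst'
  have hans : CodeFP hypInE strE (fun a => a.2.2) := (snd _ _).snd'
  have h0 : CodeFP hypInE strE (fun a => sl a.2.1 0 a.1.ℓ) := sl_code (const _ 0) (PrmT.ℓ_code.comp hπ) hseg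
  have hz : CodeFP hypInE strE (fun a => sl a.2.1 (offZ a.1.ℓ) (a.1.Q * a.1.Q)) :=
    sl_code (PrmT.ℓ_code.comp hπ) (unMul.comp ((PrmT.Q_code.comp hπ).pair (PrmT.Q_code.comp hπ))) hseg
  have hw : CodeFP hypInE strE (fun a => sl a.2.1 (offWP a.1.ℓ a.1.Q) a.1.L) := sl_code (PrmT.offWP_code.comp hπ) (PrmT.L_code.comp hπ) hseg
  have htbl : CodeFP hypInE (rawE strE) (fun a => tablesN a.1.Q a.1.ℓ a.1.n a.1.k a.1.β a.1.T a.1.L (sl a.2.1 0 a.1.ℓ)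
      (sl a.2.1 (offZ a.1.ℓ) (a.1.Q * a.1.Q)) a.2.2) :=
    (tables_codeFP.comp ((((PrmT.Q_code.comp hπ).pair ((PrmT.ℓ_code.comp hπ).pair ((PrmT.n_code.comp hπ).pair ((PrmT.k_code.comp hπ).pair
      ((PrmT.β_code.comp hπ).pair ((PrmT.T_code.comp hπ).pair (PrmT.L_code.comp hπ)))))))).pair (h0.pair (hz.pair hans)))).congr fun _ => rfl
  have hhdr : CodeFP hypInE (pairE (pairE unE (pairE unE (pairE unE unE))) (pairE unE (pairE unE (pairE unE unE))))
      (fun a => ((a.1.n, (a.1.k, (a.1.β, a.1.T))), (a.1.Q, (a.1.ℓ, (a.1.N, a.1.L))))) :=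
    (((PrmT.n_code.comp hπ).pair ((PrmT.k_code.comp hπ).pair ((PrmT.β_code.comp hπ).pair (PrmT.T_code.comp hπ)))).pair
      ((PrmT.Q_code.comp hπ).pair ((PrmT.ℓ_code.comp hπ).pair ((PrmT.N_code.comp hπ).pair (PrmT.L_code.comp hπ))))).congr fun _ => rfl
  exact (hhdr.pair (h0.pair (hw.pair (htbl.pair hz)))).congr fun _ => rfl


omit P in
/-- The unary index of a map over `range (bound)`: `min c bound`. [folklore] -/
theorem uidx_code {bound : σ → ℕ} (hb : CodeFP eσ unE bound) : CodeFP (pairE eσ natE) unE (fun q => min q.2 (bound q.1)) :=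
  (unOfNatMin.comp ((hb.comp (fst _ _)).pair (snd _ _))).congr fun _ => rfl

omit P in
/-- A map over `range (bound)` only sees indices below the bound. [folklore] -/
theorem map_range_min {γ : Type} (bound : ℕ) (g : ℕ → γ) : (List.range bound).map (fun c => g (min c bound)) = (List.range bound).map g :=
  List.map_congr_left fun c hc => by rw [min_eq_left (List.mem_range.1 hc).le]

/-- The predictor record as a string is a code. [folklore] -/
theorem predStr_code : CodeFP hypInE strE (fun a => predE (predOf a.1 a.2.1 a.2.2)) := by
  obtain ⟨F, hF, hspec⟩ := predOf_code
  exact ⟨F, hF, hspec⟩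

/-- **`vnOf` is a code.** [folklore] -/
theorem vnOf_code : CodeFP hypInE vnRecE (fun a => vnOf a.1 a.2.1 a.2.2) := by
  have hπ : CodeFP hypInE prmE (fun a => a.1) := fst _ _
  have hseg : CodeFP hypInE strE (fun a => a.2.1) := (snd _ _).fst'
  have hans : CodeFP hypInE strE (fun a => a.2.2) := (snd _ _).snd'
  have hT2 : CodeFP hypInE unE (fun a => a.1.T * 2) := (unMul.comp ((PrmT.T_code.comp hπ).pair (const _ 2))).congr fun _ => rfl
  -- `m`
  have hm : CodeFP hypInE unE (fun a => min (slv a.2.1 (offM a.1.ℓ a.1.Q a.1.L) (a.1.τ + 1) % (a.1.T * 2)) (a.1.T * 2)) :=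
    (unOfNatMin.comp (hT2.pair (natMod.comp ((slv_code (PrmT.offM_code.comp hπ) (unAdd.comp ((PrmT.τ_code.comp hπ).pair (const _ 1))) hseg).pair
      (natOfUn.comp hT2))))).congr fun _ => rfl
  -- the fillers and their labels
  have hfil : CodeFP hypInE strE (fun a => sl a.2.1 (offFil a.1.ℓ a.1.Q a.1.L a.1.τ) a.1.N) := sl_code (PrmT.offFil_code.comp hπ) (PrmT.N_code.comp hπ) hseg
  have hfans : CodeFP hypInE strE (fun a => sl a.2.2 (ansOffFil a.1) (a.1.T * 2 * a.1.k)) :=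
    sl_code (PrmT.ansOffFil_code.comp hπ) (unMul.comp (hT2.pair (PrmT.k_code.comp hπ))) hans
  have hamp : CodeFP hypInE ampArgE (fun a => ((a.1.n, (a.1.k, (a.1.β, a.1.T))), (sl a.2.1 (offFil a.1.ℓ a.1.Q a.1.L a.1.τ) a.1.N,
      sl a.2.2 (ansOffFil a.1) (a.1.T * 2 * a.1.k)))) :=
    ((((PrmT.n_code.comp hπ).pair ((PrmT.k_code.comp hπ).pair ((PrmT.β_code.comp hπ).pair (PrmT.T_code.comp hπ)))).pair (hfil.pair hfans))).congr
      fun _ => rfl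
  have hlabR : CodeFP hypInE (rawE natE) (fun a => (List.range (a.1.T * 2)).map fun c => blkValN 𝔭 a.1.n a.1.k a.1.β
      (sl a.2.1 (offFil a.1.ℓ a.1.Q a.1.L a.1.τ) a.1.N) (sl a.2.2 (ansOffFil a.1) (a.1.T * 2 * a.1.k)) c) :=
    ((CodeFP.map (((blkValN_codeFP 𝔭).comp ((hamp.comp (fst _ _)).pair (snd _ _))).congr fun _ => rfl)).comp
      ((CodeFP.id _).pair (urange.comp hT2))).congr fun _ => by simp only [id]
  -- the ideal labels, `u`, `u'`
  have hβ₁ : CodeFP (pairE hypInE natE) unE (fun s => s.1.1.β) := (PrmT.β_code.comp (hπ.comp (fst _ _))).congr fun _ => rfl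
  have hseg₁ : CodeFP (pairE hypInE natE) strE (fun s => s.1.2.1) := (hseg.comp (fst _ _)).congr fun _ => rfl
  have hoffA : CodeFP (pairE hypInE natE) unE (fun q => offLab q.1.1.n q.1.1.k q.1.1.β q.1.1.T q.1.1.ℓ q.1.1.Q q.1.1.L q.1.1.τ +
      min q.2 (q.1.1.T * 2) * q.1.1.β) :=
    (unAdd.comp ((PrmT.offLab_code.comp (hπ.comp (fst _ _))).pair (unMul.comp ((uidx_code hT2).pair hβ₁)))).congr fun _ => rfl
  have hitemA : CodeFP (pairE hypInE natE) natE (fun q => fieldAt q.1.1 q.1.2.1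
      (offLab q.1.1.n q.1.1.k q.1.1.β q.1.1.T q.1.1.ℓ q.1.1.Q q.1.1.L q.1.1.τ + min q.2 (q.1.1.T * 2) * q.1.1.β)) :=
    (fieldAt_code (π := fun q => q.1.1) hβ₁ hoffA hseg₁).congr fun _ => rfl
  have hlabA : CodeFP hypInE (rawE natE) (fun a => (List.range (a.1.T * 2)).map fun c =>
      fieldAt a.1 a.2.1 (offLab a.1.n a.1.k a.1.β a.1.T a.1.ℓ a.1.Q a.1.L a.1.τ + c * a.1.β)) :=
    ((CodeFP.map hitemA).comp ((CodeFP.id _).pair (urange.comp hT2))).congr fun a =>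
      map_range_min (a.1.T * 2) fun c => fieldAt a.1 a.2.1 (offLab a.1.n a.1.k a.1.β a.1.T a.1.ℓ a.1.Q a.1.L a.1.τ + c * a.1.β)
  have hβ₀ : CodeFP hypInE unE (fun a => a.1.β) := (PrmT.β_code.comp hπ).congr fun _ => rfl
  have hoU : CodeFP hypInE unE (fun a => offU a.1.n a.1.k a.1.β a.1.T a.1.ℓ a.1.Q a.1.L a.1.τ) := (PrmT.offU_code.comp hπ).congr fun _ => rfl
  have hoU' : CodeFP hypInE unE (fun a => offU a.1.n a.1.k a.1.β a.1.T a.1.ℓ a.1.Q a.1.L a.1.τ + a.1.β) := (unAdd.comp (hoU.pair hβ₀)).congr fun _ => rfl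
  have hu : CodeFP hypInE natE (fun a => fieldAt a.1 a.2.1 (offU a.1.n a.1.k a.1.β a.1.T a.1.ℓ a.1.Q a.1.L a.1.τ)) :=
    (fieldAt_code (π := fun a => a.1) hβ₀ hoU hseg).congr fun _ => rfl
  have hu' : CodeFP hypInE natE (fun a => fieldAt a.1 a.2.1 (offU a.1.n a.1.k a.1.β a.1.T a.1.ℓ a.1.Q a.1.L a.1.τ + a.1.β)) :=
    (fieldAt_code (π := fun a => a.1) hβ₀ hoU' hseg).congr fun _ => rfl
  exact ((predStr_code.pair (hm.pair (hfil.pair (hlabR.pair (hlabA.pair (hu.pair hu'))))))).congr fun _ => rfl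

/-- **`glOf` is a code.** [folklore] -/
theorem glOf_code : CodeFP hypInE (glRecE 𝔭) (fun a => glOf a.1 a.2.1 a.2.2) := by
  have hπ : CodeFP hypInE prmE (fun a => a.1) := fst _ _
  have hseg : CodeFP hypInE strE (fun a => a.2.1) := (snd _ _).fst'
  have hk : CodeFP hypInE unE (fun a => a.1.k) := (PrmT.k_code.comp hπ).congr fun _ => rfl
  have hkk : CodeFP hypInE unE (fun a => a.1.kk) := (PrmT.kk_code.comp hπ).congr fun _ => rfl
  -- seeds: context `⟨a, tt⟩`, item `j`
  let e₂ := pairE (pairE hypInE natE) natE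
  have hA₂ : CodeFP e₂ hypInE (fun q => q.1.1) := (fst _ _).fst'
  have htt : CodeFP e₂ unE (fun q => min q.1.2 q.1.1.1.kk) := ((uidx_code hkk).comp (fst _ _)).congr fun _ => rfl
  have hj : CodeFP e₂ unE (fun q => min q.2 q.1.1.1.k) := (unOfNatMin.comp ((hk.comp hA₂).pair (snd _ _))).congr fun _ => rfl
  have hoffS : CodeFP e₂ unE (fun q => offSeeds q.1.1.1.n q.1.1.1.k q.1.1.1.β q.1.1.1.T q.1.1.1.ℓ q.1.1.1.Q q.1.1.1.L q.1.1.1.τ +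
      (min q.1.2 q.1.1.1.kk * q.1.1.1.k + min q.2 q.1.1.1.k) * q.1.1.1.β) :=
    (unAdd.comp ((PrmT.offSeeds_code.comp (hπ.comp hA₂)).pair (unMul.comp ((unAdd.comp ((unMul.comp (htt.pair (hk.comp hA₂))).pair hj)).pair
      (PrmT.β_code.comp (hπ.comp hA₂)))))).congr fun _ => rfl
  have hβ₂ : CodeFP e₂ unE (fun q => q.1.1.1.β) := (PrmT.β_code.comp (hπ.comp hA₂)).congr fun _ => rfl
  have hseg₂ : CodeFP e₂ strE (fun q => q.1.1.2.1) := (hseg.comp hA₂).congr fun _ => rfl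
  have hfS : CodeFP e₂ natE (fun q => fieldAt q.1.1.1 q.1.1.2.1 (offSeeds q.1.1.1.n q.1.1.1.k q.1.1.1.β q.1.1.1.T q.1.1.1.ℓ q.1.1.1.Q
      q.1.1.1.L q.1.1.1.τ + (min q.1.2 q.1.1.1.kk * q.1.1.1.k + min q.2 q.1.1.1.k) * q.1.1.1.β)) :=
    (fieldAt_code (π := fun q => q.1.1.1) hβ₂ hoffS hseg₂).congr fun _ => rfl
  have hseedItem : CodeFP e₂ (zmodE 𝔭) (fun q => ((fieldAt q.1.1.1 q.1.1.2.1 (offSeeds q.1.1.1.n q.1.1.1.k q.1.1.1.β q.1.1.1.T q.1.1.1.ℓ q.1.1.1.Q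
      q.1.1.1.L q.1.1.1.τ + (min q.1.2 q.1.1.1.kk * q.1.1.1.k + min q.2 q.1.1.1.k) * q.1.1.1.β) : ℕ) : ZMod 𝔭)) :=
    (zmodOfNat.comp hfS).congr fun _ => rfl
  have hseedRow : CodeFP (pairE hypInE natE) (rowE 𝔭) (fun s => (List.range s.1.1.k).map fun j =>
      ((fieldAt s.1.1 s.1.2.1 (offSeeds s.1.1.n s.1.1.k s.1.1.β s.1.1.T s.1.1.ℓ s.1.1.Q s.1.1.L s.1.1.τ +
        (min s.2 s.1.1.kk * s.1.1.k + j) * s.1.1.β) : ℕ) : ZMod 𝔭)) :=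
    ((CodeFP.map hseedItem).comp ((CodeFP.id _).pair (urange.comp (hk.comp (fst _ _))))).congr fun s => by
      simp only [id]
      exact map_range_min s.1.1.k fun j => ((fieldAt s.1.1 s.1.2.1 (offSeeds s.1.1.n s.1.1.k s.1.1.β s.1.1.T s.1.1.ℓ s.1.1.Q s.1.1.L s.1.1.τ +
        (min s.2 s.1.1.kk * s.1.1.k + j) * s.1.1.β) : ℕ) : ZMod 𝔭)
  have hseeds : CodeFP hypInE (rawE (rowE 𝔭)) (fun a => (List.range a.1.kk).map fun tt => (List.range a.1.k).map fun j =>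
      ((fieldAt a.1 a.2.1 (offSeeds a.1.n a.1.k a.1.β a.1.T a.1.ℓ a.1.Q a.1.L a.1.τ + (tt * a.1.k + j) * a.1.β) : ℕ) : ZMod 𝔭)) :=
    ((CodeFP.map hseedRow).comp ((CodeFP.id _).pair (urange.comp hkk))).congr fun a => by
      simp only [id]
      exact map_range_min a.1.kk fun tt => (List.range a.1.k).map fun j =>
        ((fieldAt a.1 a.2.1 (offSeeds a.1.n a.1.k a.1.β a.1.T a.1.ℓ a.1.Q a.1.L a.1.τ + (tt * a.1.k + j) * a.1.β) : ℕ) : ZMod 𝔭)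
  -- guesses
  have hβ₁ : CodeFP (pairE hypInE natE) unE (fun s => s.1.1.β) := (PrmT.β_code.comp (hπ.comp (fst _ _))).congr fun _ => rfl
  have hseg₁ : CodeFP (pairE hypInE natE) strE (fun s => s.1.2.1) := (hseg.comp (fst _ _)).congr fun _ => rfl
  have hoffG : CodeFP (pairE hypInE natE) unE (fun s => offGuess s.1.1.n s.1.1.k s.1.1.β s.1.1.T s.1.1.ℓ s.1.1.Q s.1.1.L s.1.1.kk s.1.1.τ +
      min s.2 s.1.1.kk * s.1.1.β) :=
    (unAdd.comp ((PrmT.offGuess_code.comp (hπ.comp (fst _ _))).pair (unMul.comp ((uidx_code hkk).pair hβ₁)))).congr fun _ => rfl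
  have hfG : CodeFP (pairE hypInE natE) natE (fun s => fieldAt s.1.1 s.1.2.1
      (offGuess s.1.1.n s.1.1.k s.1.1.β s.1.1.T s.1.1.ℓ s.1.1.Q s.1.1.L s.1.1.kk s.1.1.τ + min s.2 s.1.1.kk * s.1.1.β)) :=
    (fieldAt_code (π := fun s => s.1.1) hβ₁ hoffG hseg₁).congr fun _ => rfl
  have hguessItem : CodeFP (pairE hypInE natE) (zmodE 𝔭) (fun s => ((fieldAt s.1.1 s.1.2.1
      (offGuess s.1.1.n s.1.1.k s.1.1.β s.1.1.T s.1.1.ℓ s.1.1.Q s.1.1.L s.1.1.kk s.1.1.τ + min s.2 s.1.1.kk * s.1.1.β) : ℕ) : ZMod 𝔭)) :=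
    (zmodOfNat.comp hfG).congr fun _ => rfl
  have hguess : CodeFP hypInE (rowE 𝔭) (fun a => (List.range a.1.kk).map fun tt =>
      ((fieldAt a.1 a.2.1 (offGuess a.1.n a.1.k a.1.β a.1.T a.1.ℓ a.1.Q a.1.L a.1.kk a.1.τ + tt * a.1.β) : ℕ) : ZMod 𝔭)) :=
    ((CodeFP.map hguessItem).comp ((CodeFP.id _).pair (urange.comp hkk))).congr fun a => by
      simp only [id]
      exact map_range_min a.1.kk fun tt =>
        ((fieldAt a.1 a.2.1 (offGuess a.1.n a.1.k a.1.β a.1.T a.1.ℓ a.1.Q a.1.L a.1.kk a.1.τ + tt * a.1.β) : ℕ) : ZMod 𝔭)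
  have hdims : CodeFP hypInE (pairE unE (pairE unE unE)) (fun a => (a.1.n, (a.1.k, a.1.β))) :=
    ((PrmT.n_code.comp hπ).pair (hk.pair (PrmT.β_code.comp hπ))).congr fun _ => rfl
  exact (vnOf_code.pair (hdims.pair (hkk.pair ((PrmT.KK_code.comp hπ).pair (hseeds.pair (hguess.pair ((PrmT.θN_code.comp hπ).pair
    (PrmT.θD_code.comp hπ)))))))).congr fun _ => rfl

/-- **The hypothesis recipe `hypN` is a polynomial-time code.** [cite: CarmosinoImpagliazzoKabanetsKolokolova2016, Thm. 5.1 (running time)] -/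
theorem hypN_code : CodeFP hypInE (hypOutE 𝔭) (fun a => hypN a.1 a.2.1 a.2.2) := by
  have hπ : CodeFP hypInE prmE (fun a => a.1) := fst _ _
  have hseg : CodeFP hypInE strE (fun a => a.2.1) := (snd _ _).fst'
  have hans : CodeFP hypInE strE (fun a => a.2.2) := (snd _ _).snd'
  have hk : CodeFP hypInE unE (fun a => a.1.k) := (PrmT.k_code.comp hπ).congr fun _ => rfl
  have hn : CodeFP hypInE unE (fun a => a.1.n) := (PrmT.n_code.comp hπ).congr fun _ => rfl
  have hβ : CodeFP hypInE unE (fun a => a.1.β) := (PrmT.β_code.comp hπ).congr fun _ => rfl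
  have ht : CodeFP hypInE unE (fun a => a.1.t) := (PrmT.t_code.comp hπ).congr fun _ => rfl
  have hnβ : CodeFP hypInE unE (fun a => a.1.n + a.1.β) := (unAdd.comp (hn.pair hβ)).congr fun _ => rfl
  have hoT : CodeFP hypInE unE (fun a => offTup a.1.n a.1.k a.1.β a.1.T a.1.ℓ a.1.Q a.1.L a.1.kk a.1.τ) := (PrmT.offTup_code.comp hπ).congr fun _ => rfl
  have hoS : CodeFP hypInE unE (fun a => offSteps a.1.n a.1.k a.1.β a.1.T a.1.ℓ a.1.Q a.1.L a.1.kk a.1.τ) :=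
    (PrmT.offSteps_code.comp hπ).congr fun _ => rfl
  have hsL : CodeFP hypInE unE (fun a => stepLenP a.1.n a.1.k a.1.β a.1.κ) := (PrmT.stepLenP_code.comp hπ).congr fun _ => rfl
  -- `Pb`
  have hPb : CodeFP hypInE strE (fun a => sl a.2.1 (offPbP a.1.n a.1.k a.1.β a.1.T a.1.ℓ a.1.Q a.1.L a.1.kk a.1.τ) a.1.k) :=
    sl_code ((PrmT.offPbP_code.comp hπ).congr fun _ => rfl) hk hseg
  -- the tuple rows: context `a`, item `i`
  have hn₁ : CodeFP (pairE hypInE natE) unE (fun s => s.1.1.n) := (hn.comp (fst _ _)).congr fun _ => rfl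
  have hβ₁ : CodeFP (pairE hypInE natE) unE (fun s => s.1.1.β) := (hβ.comp (fst _ _)).congr fun _ => rfl
  have hseg₁ : CodeFP (pairE hypInE natE) strE (fun s => s.1.2.1) := (hseg.comp (fst _ _)).congr fun _ => rfl
  have hi₁ : CodeFP (pairE hypInE natE) unE (fun s => min s.2 s.1.1.k) := uidx_code hk
  have hox : CodeFP (pairE hypInE natE) unE (fun s => offTup s.1.1.n s.1.1.k s.1.1.β s.1.1.T s.1.1.ℓ s.1.1.Q s.1.1.L s.1.1.kk s.1.1.τ +
      min s.2 s.1.1.k * (s.1.1.n + s.1.1.β)) :=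
    (unAdd.comp ((hoT.comp (fst _ _)).pair (unMul.comp (hi₁.pair (hnβ.comp (fst _ _)))))).congr fun _ => rfl
  have hoy : CodeFP (pairE hypInE natE) unE (fun s => offTup s.1.1.n s.1.1.k s.1.1.β s.1.1.T s.1.1.ℓ s.1.1.Q s.1.1.L s.1.1.kk s.1.1.τ +
      min s.2 s.1.1.k * (s.1.1.n + s.1.1.β) + s.1.1.n) := (unAdd.comp (hox.pair hn₁)).congr fun _ => rfl
  have hrow : CodeFP (pairE hypInE natE) strE (fun s => pointJunkStr s.1.1 s.1.2.1
      (offTup s.1.1.n s.1.1.k s.1.1.β s.1.1.T s.1.1.ℓ s.1.1.Q s.1.1.L s.1.1.kk s.1.1.τ + min s.2 s.1.1.k * (s.1.1.n + s.1.1.β))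
      (offTup s.1.1.n s.1.1.k s.1.1.β s.1.1.T s.1.1.ℓ s.1.1.Q s.1.1.L s.1.1.kk s.1.1.τ + min s.2 s.1.1.k * (s.1.1.n + s.1.1.β) + s.1.1.n)) :=
    (pointJunkStr_code (π := fun s => s.1.1) hn₁ hβ₁ hox hoy hseg₁).congr fun _ => rfl
  have habits : CodeFP hypInE strE (fun a => ((List.range a.1.k).map fun i => pointJunkStr a.1 a.2.1
      (offTup a.1.n a.1.k a.1.β a.1.T a.1.ℓ a.1.Q a.1.L a.1.kk a.1.τ + i * (a.1.n + a.1.β))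
      (offTup a.1.n a.1.k a.1.β a.1.T a.1.ℓ a.1.Q a.1.L a.1.kk a.1.τ + i * (a.1.n + a.1.β) + a.1.n)).flatten) :=
    (strFlatten.comp ((CodeFP.map hrow).comp ((CodeFP.id _).pair (urange.comp hk)))).congr fun a =>
      congrArg List.flatten (map_range_min a.1.k fun i => pointJunkStr a.1 a.2.1
        (offTup a.1.n a.1.k a.1.β a.1.T a.1.ℓ a.1.Q a.1.L a.1.kk a.1.τ + i * (a.1.n + a.1.β))
        (offTup a.1.n a.1.k a.1.β a.1.T a.1.ℓ a.1.Q a.1.L a.1.kk a.1.τ + i * (a.1.n + a.1.β) + a.1.n))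
  -- the DP answers
  have hvb : CodeFP hypInE strE (fun a => sl a.2.2 (ansOffTup a.1) a.1.k) := sl_code ((PrmT.ansOffTup_code.comp hπ).congr fun _ => rfl) hk hans
  -- the steps: context `⟨a, r⟩`, rows item `i`
  let e₂ := pairE (pairE hypInE natE) natE
  have hA₂ : CodeFP e₂ hypInE (fun q => q.1.1) := (fst _ _).fst'
  have hn₂ : CodeFP e₂ unE (fun q => q.1.1.1.n) := (hn.comp hA₂).congr fun _ => rfl
  have hβ₂ : CodeFP e₂ unE (fun q => q.1.1.1.β) := (hβ.comp hA₂).congr fun _ => rfl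
  have hseg₂ : CodeFP e₂ strE (fun q => q.1.1.2.1) := (hseg.comp hA₂).congr fun _ => rfl
  have hr₂ : CodeFP e₂ unE (fun q => min q.1.2 q.1.1.1.t) := ((uidx_code ht).comp (fst _ _)).congr fun _ => rfl
  have hi₂ : CodeFP e₂ unE (fun q => min q.2 q.1.1.1.k) := (unOfNatMin.comp ((hk.comp hA₂).pair (snd _ _))).congr fun _ => rfl
  have hbase₂ : CodeFP e₂ unE (fun q => offSteps q.1.1.1.n q.1.1.1.k q.1.1.1.β q.1.1.1.T q.1.1.1.ℓ q.1.1.1.Q q.1.1.1.L q.1.1.1.kk q.1.1.1.τ +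
      min q.1.2 q.1.1.1.t * stepLenP q.1.1.1.n q.1.1.1.k q.1.1.1.β q.1.1.1.κ + q.1.1.1.κ) :=
    (unAdd.comp ((unAdd.comp ((hoS.comp hA₂).pair (unMul.comp (hr₂.pair (hsL.comp hA₂))))).pair (PrmT.κ_code.comp (hπ.comp hA₂)))).congr fun _ => rfl
  have hox₂ : CodeFP e₂ unE (fun q => offSteps q.1.1.1.n q.1.1.1.k q.1.1.1.β q.1.1.1.T q.1.1.1.ℓ q.1.1.1.Q q.1.1.1.L q.1.1.1.kk q.1.1.1.τ +
      min q.1.2 q.1.1.1.t * stepLenP q.1.1.1.n q.1.1.1.k q.1.1.1.β q.1.1.1.κ + q.1.1.1.κ + min q.2 q.1.1.1.k * (q.1.1.1.n + q.1.1.1.β)) :=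
    (unAdd.comp (hbase₂.pair (unMul.comp (hi₂.pair (hnβ.comp hA₂))))).congr fun _ => rfl
  have hoy₂ : CodeFP e₂ unE (fun q => offSteps q.1.1.1.n q.1.1.1.k q.1.1.1.β q.1.1.1.T q.1.1.1.ℓ q.1.1.1.Q q.1.1.1.L q.1.1.1.kk q.1.1.1.τ +
      min q.1.2 q.1.1.1.t * stepLenP q.1.1.1.n q.1.1.1.k q.1.1.1.β q.1.1.1.κ + q.1.1.1.κ + min q.2 q.1.1.1.k * (q.1.1.1.n + q.1.1.1.β) + q.1.1.1.n) :=
    (unAdd.comp (hox₂.pair hn₂)).congr fun _ => rfl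
  have hrow₂ : CodeFP e₂ strE (fun q => pointJunkStr q.1.1.1 q.1.1.2.1
      (offSteps q.1.1.1.n q.1.1.1.k q.1.1.1.β q.1.1.1.T q.1.1.1.ℓ q.1.1.1.Q q.1.1.1.L q.1.1.1.kk q.1.1.1.τ +
        min q.1.2 q.1.1.1.t * stepLenP q.1.1.1.n q.1.1.1.k q.1.1.1.β q.1.1.1.κ + q.1.1.1.κ + min q.2 q.1.1.1.k * (q.1.1.1.n + q.1.1.1.β))
      (offSteps q.1.1.1.n q.1.1.1.k q.1.1.1.β q.1.1.1.T q.1.1.1.ℓ q.1.1.1.Q q.1.1.1.L q.1.1.1.kk q.1.1.1.τ +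
        min q.1.2 q.1.1.1.t * stepLenP q.1.1.1.n q.1.1.1.k q.1.1.1.β q.1.1.1.κ + q.1.1.1.κ + min q.2 q.1.1.1.k * (q.1.1.1.n + q.1.1.1.β) + q.1.1.1.n)) :=
    (pointJunkStr_code (π := fun q => q.1.1.1) hn₂ hβ₂ hox₂ hoy₂ hseg₂).congr fun _ => rfl
  have hrows : CodeFP (pairE hypInE natE) strE (fun s => ((List.range s.1.1.k).map fun i => pointJunkStr s.1.1 s.1.2.1
      (offSteps s.1.1.n s.1.1.k s.1.1.β s.1.1.T s.1.1.ℓ s.1.1.Q s.1.1.L s.1.1.kk s.1.1.τ +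
        min s.2 s.1.1.t * stepLenP s.1.1.n s.1.1.k s.1.1.β s.1.1.κ + s.1.1.κ + i * (s.1.1.n + s.1.1.β))
      (offSteps s.1.1.n s.1.1.k s.1.1.β s.1.1.T s.1.1.ℓ s.1.1.Q s.1.1.L s.1.1.kk s.1.1.τ +
        min s.2 s.1.1.t * stepLenP s.1.1.n s.1.1.k s.1.1.β s.1.1.κ + s.1.1.κ + i * (s.1.1.n + s.1.1.β) + s.1.1.n)).flatten) :=
    (strFlatten.comp ((CodeFP.map hrow₂).comp ((CodeFP.id _).pair (urange.comp (hk.comp (fst _ _)))))).congr fun s =>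
      congrArg List.flatten (map_range_min s.1.1.k fun i => pointJunkStr s.1.1 s.1.2.1
        (offSteps s.1.1.n s.1.1.k s.1.1.β s.1.1.T s.1.1.ℓ s.1.1.Q s.1.1.L s.1.1.kk s.1.1.τ +
          min s.2 s.1.1.t * stepLenP s.1.1.n s.1.1.k s.1.1.β s.1.1.κ + s.1.1.κ + i * (s.1.1.n + s.1.1.β))
        (offSteps s.1.1.n s.1.1.k s.1.1.β s.1.1.T s.1.1.ℓ s.1.1.Q s.1.1.L s.1.1.kk s.1.1.τ +
          min s.2 s.1.1.t * stepLenP s.1.1.n s.1.1.k s.1.1.β s.1.1.κ + s.1.1.κ + i * (s.1.1.n + s.1.1.β) + s.1.1.n))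
  have hidx : CodeFP (pairE hypInE natE) unE (fun s => min (slv s.1.2.1 (offSteps s.1.1.n s.1.1.k s.1.1.β s.1.1.T s.1.1.ℓ s.1.1.Q s.1.1.L s.1.1.kk s.1.1.τ +
      min s.2 s.1.1.t * stepLenP s.1.1.n s.1.1.k s.1.1.β s.1.1.κ) s.1.1.κ % s.1.1.k) s.1.1.k) := by
    have hb : CodeFP (pairE hypInE natE) unE (fun s => offSteps s.1.1.n s.1.1.k s.1.1.β s.1.1.T s.1.1.ℓ s.1.1.Q s.1.1.L s.1.1.kk s.1.1.τ +
        min s.2 s.1.1.t * stepLenP s.1.1.n s.1.1.k s.1.1.β s.1.1.κ) :=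
      (unAdd.comp ((hoS.comp (fst _ _)).pair (unMul.comp ((uidx_code ht).pair (hsL.comp (fst _ _)))))).congr fun _ => rfl
    have hv : CodeFP (pairE hypInE natE) natE (fun s => slv s.1.2.1 (offSteps s.1.1.n s.1.1.k s.1.1.β s.1.1.T s.1.1.ℓ s.1.1.Q s.1.1.L s.1.1.kk s.1.1.τ +
        min s.2 s.1.1.t * stepLenP s.1.1.n s.1.1.k s.1.1.β s.1.1.κ) s.1.1.κ) :=
      (slv_code hb ((PrmT.κ_code.comp (hπ.comp (fst _ _))).congr fun _ => rfl) hseg₁).congr fun _ => rfl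
    exact (unOfNatMin.comp ((hk.comp (fst _ _)).pair (natMod.comp (hv.pair (natOfUn.comp (hk.comp (fst _ _))))))).congr fun _ => rfl
  have hsteps : CodeFP hypInE (rawE (pairE unE strE)) (fun a => (List.range a.1.t).map fun r =>
      (min (slv a.2.1 (offSteps a.1.n a.1.k a.1.β a.1.T a.1.ℓ a.1.Q a.1.L a.1.kk a.1.τ + r * stepLenP a.1.n a.1.k a.1.β a.1.κ) a.1.κ % a.1.k) a.1.k,
       ((List.range a.1.k).map fun i => pointJunkStr a.1 a.2.1
          (offSteps a.1.n a.1.k a.1.β a.1.T a.1.ℓ a.1.Q a.1.L a.1.kk a.1.τ + r * stepLenP a.1.n a.1.k a.1.β a.1.κ + a.1.κ + i * (a.1.n + a.1.β))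
          (offSteps a.1.n a.1.k a.1.β a.1.T a.1.ℓ a.1.Q a.1.L a.1.kk a.1.τ + r * stepLenP a.1.n a.1.k a.1.β a.1.κ + a.1.κ + i * (a.1.n + a.1.β) +
            a.1.n)).flatten)) :=
    ((CodeFP.map (hidx.pair hrows)).comp ((CodeFP.id _).pair (urange.comp ht))).congr fun a =>
      map_range_min a.1.t fun r =>
        (min (slv a.2.1 (offSteps a.1.n a.1.k a.1.β a.1.T a.1.ℓ a.1.Q a.1.L a.1.kk a.1.τ + r * stepLenP a.1.n a.1.k a.1.β a.1.κ) a.1.κ % a.1.k) a.1.k,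
         ((List.range a.1.k).map fun i => pointJunkStr a.1 a.2.1
            (offSteps a.1.n a.1.k a.1.β a.1.T a.1.ℓ a.1.Q a.1.L a.1.kk a.1.τ + r * stepLenP a.1.n a.1.k a.1.β a.1.κ + a.1.κ + i * (a.1.n + a.1.β))
            (offSteps a.1.n a.1.k a.1.β a.1.T a.1.ℓ a.1.Q a.1.L a.1.kk a.1.τ + r * stepLenP a.1.n a.1.k a.1.β a.1.κ + a.1.κ + i * (a.1.n + a.1.β) +
              a.1.n)).flatten)
  -- the junk bits
  have hq : CodeFP hypInE strE (fun a => (natE (junkAt a.1 a.2.1 (offJunk a.1.n a.1.k a.1.β a.1.T a.1.ℓ a.1.Q a.1.L a.1.kk a.1.t a.1.κ a.1.τ))).takeD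
      a.1.β false) :=
    (junkStr_code (π := fun a => a.1) hβ ((PrmT.offJunk_code.comp hπ).congr fun _ => rfl) hseg).congr fun _ => rfl
  -- assemble
  have hdims : CodeFP hypInE (pairE unE (pairE unE unE)) (fun a => (a.1.n + a.1.β, (a.1.k, a.1.t))) := (hnβ.pair (hk.pair ht)).congr fun _ => rfl
  exact ((glOf_code.pair (hdims.pair (hPb.pair (habits.pair (hvb.pair hsteps))))).pair hq).congr fun _ => rfl

/-- **The hypothesis function** of the `AC⁰[p]` learner: one run's hypothesis record from
`⟨π, ⟨seg, ans⟩⟩`. [cite: CarmosinoImpagliazzoKabanetsKolokolova2016, §5 (complete algorithm)] -/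
noncomputable def hypPFn : List Bool → List Bool := Classical.choose hypN_code

/-- `hypPFn ∈ FP`. [cite: CarmosinoImpagliazzoKabanetsKolokolova2016, Thm. 5.1 (running time)] -/
theorem hypPFn_mem_FP : hypPFn ∈ FP := (Classical.choose_spec hypN_code).1

/-- **Value of `hypPFn`.** [folklore] -/
theorem hypPFn_apply (π : PrmT) (seg ans : List Bool) : hypPFn (hypInE (π, (seg, ans))) = hypOutE 𝔭 (hypN π seg ans) := by
  have h := (Classical.choose_spec hypN_code).2 (π, (seg, ans))
  unfold hypPFn
  rw [h]

end Code

end Modp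

end Literature.Computability.Learning
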